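import Literature.Probability.RandomPlanarGeometry.RadialBesselComparison
import HarnessLib

/-!
# The radial Bessel flow: dependence on the path, the flow (cocycle) property, joint measurability

Topic `Probability/RandomPlanarGeometry`; theorems and one auxiliary definition (`shiftFam`, the
time-shifted family of driving paths), sequel of `RadialBesselFlow`, `RadialBesselExit`,
`RadialBesselComparison`. Three deterministic facts about the radial Bessel flow
`Yₜ = θ + ∫₀ᵗ cot(Y_s/2) ds - (Uₜ - U₀)` of LSW (2002), (2.9)–(2.11) / Lawler (2005), (6.12), and
about its truncations `Y^δ`, exit times `σ_δ`, `σₙ`, lifetime `T` and exit sides, all of which are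
consequences of the uniqueness of the integrated equation (`eqOn_argTrunc_of_integral_eq`):

* **dependence on the increments of the path only** (`argTrunc_congr`, `truncExit_congr`,
  `lifetime_congr`, `exitsTop_congr`, `exitsBot_congr`, `arg_congr`): two families of driving
  paths which have the same increments at two sample points produce the same flow, exit times,
  lifetime and exit side there;
* **the flow property** (`argTrunc_add`, `truncExit_eq_add`, `exitLevel_eq_add`,
  `lifetime_eq_add`, `exitsTop_iff_shiftFam`, `exitsBot_iff_shiftFam`, `arg_add`): restarting at
  time `r` from the current position and driving by the shifted path `u ↦ U(r + u)` reproduces the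
  flow after `r`; exit times and the lifetime split as `σ = r + σ'`, `T = r + T'` when `r` is
  before them, and the exit side is that of the restarted flow. This is the deterministic half of
  the (strong) Markov property of the radial Bessel process used in LSW (2002), proof of
  Lemma 2.2 ("`h(θ, t) = E[h(Y_T, t - T)]`", (2.10)) and in Lawler (2005), §1.11;
* **joint measurability in the starting point and the sample** (`measurable_argTrunc_prod`,
  `measurable_exitLevel_prod`, `measurableSet_topAt_prod`, `measurableSet_exitsTop_prod`,
  `measurableSet_exitsBot_prod`, `measurable_lifetime_prod`, `measurable_arg_min_exitLevel_prod`):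
  the flow is `1`-Lipschitz in the
  starting point (`sub_argTrunc_mem_Icc`), hence jointly measurable (Carathéodory), and the exit
  data are hitting functionals of the jointly measurable continuous process on `ℝ × Ω`. This is
  what makes `(y, ω) ↦ φ(T(y, ω)) 1_{Y_T = 2π}` an admissible integrand for the freezing formula
  at a stopping time (`BrownianStrongMarkov`).

## References

* G. F. Lawler, O. Schramm, W. Werner, *One-arm exponent for critical 2D percolation*, Electron.
  J. Probab. 7 (2002), no. 2, §2: (2.9)–(2.11), proof of Lemma 2.2. [LawlerSchrammWernerEJP2002]
* G. F. Lawler, *Conformally Invariant Processes in the Plane*, AMS (2005), §1.11, §6.4 (6.12).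
  [Lawler2005]
-/

noncomputable section

open MeasureTheory Filter Topology Set
open scoped NNReal ENNReal

namespace Literature.Probability.RandomPlanarGeometry

namespace RadialLoewner

/-! ### A `WithTop ℝ≥0` helper -/

/-- Two extended times with the same upper bounds among finite times are equal. [folklore] -/
theorem withTop_eq_of_forall_le_coe_iff {a b : WithTop ℝ≥0}
    (h : ∀ t : ℝ≥0, a ≤ (t : WithTop ℝ≥0) ↔ b ≤ (t : WithTop ℝ≥0)) : a = b := by
  induction a using WithTop.recTopCoe with
  | top =>
    induction b using WithTop.recTopCoe with
    | top => rfl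
    | coe s => exact absurd (top_le_iff.1 ((h s).2 le_rfl)) WithTop.coe_ne_top
  | coe r =>
    induction b using WithTop.recTopCoe with
    | top => exact absurd (top_le_iff.1 ((h r).1 le_rfl)) WithTop.coe_ne_top
    | coe s =>
      exact le_antisymm ((h s).2 le_rfl) ((h r).1 le_rfl)

/-- `⨆ₙ (r + gₙ) = r + ⨆ₙ gₙ` in `WithTop ℝ≥0`. [folklore] -/
theorem iSup_coe_add_eq (r : ℝ≥0) (g : ℕ → WithTop ℝ≥0) :
    (⨆ n, ((r : WithTop ℝ≥0) + g n)) = (r : WithTop ℝ≥0) + ⨆ n, g n := by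
  refine withTop_eq_of_forall_le_coe_iff fun t ↦ ?_
  rw [iSup_le_iff]
  constructor
  · intro h
    have hrt : r ≤ t := WithTop.coe_le_coe.1 (le_trans le_self_add (h 0))
    have hgn : ∀ n, g n ≤ ((t - r : ℝ≥0) : WithTop ℝ≥0) := by
      intro n
      have hn := h n
      by_cases htop : g n = ⊤
      · rw [htop, WithTop.add_top] at hn
        exact absurd (top_le_iff.1 hn) WithTop.coe_ne_top
      · obtain ⟨s, hs⟩ := WithTop.ne_top_iff_exists.1 htop
        rw [← hs] at hn ⊢
        rw [← WithTop.coe_add, WithTop.coe_le_coe] at hn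
        exact WithTop.coe_le_coe.2 (le_tsub_of_add_le_left hn)
    calc (r : WithTop ℝ≥0) + ⨆ n, g n ≤ (r : WithTop ℝ≥0) + ((t - r : ℝ≥0) : WithTop ℝ≥0) :=
          add_le_add le_rfl (iSup_le hgn)
      _ = (t : WithTop ℝ≥0) := by rw [← WithTop.coe_add, add_tsub_cancel_of_le hrt]
  · intro h n
    exact (add_le_add le_rfl (le_iSup g n)).trans h

/-- Exit times of processes with the same path agree (the exit time is a functional of the
path). [folklore] -/
theorem exitTime_eq_of_forall_eq {Ω Ω' : Type*} {u : ℝ≥0 → Ω → ℝ} {u' : ℝ≥0 → Ω' → ℝ}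
    {ω : Ω} {ω' : Ω'} (h : ∀ t, u t ω = u' t ω') (a b : ℝ) :
    Process.exitTime u a b ω = Process.exitTime u' a b ω' := by
  unfold Process.exitTime hittingAfter
  have hiff : (∃ j, (0 : ℝ≥0) ≤ j ∧ u j ω ∈ (Ioo a b)ᶜ) ↔ ∃ j, (0 : ℝ≥0) ≤ j ∧ u' j ω' ∈ (Ioo a b)ᶜ := by
    simp only [h]
  have hset : {i : ℝ≥0 | 0 ≤ i ∧ u i ω ∈ (Ioo a b)ᶜ} = {i | 0 ≤ i ∧ u' i ω' ∈ (Ioo a b)ᶜ} := by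
    simp only [h]
  by_cases h₁ : ∃ j, (0 : ℝ≥0) ≤ j ∧ u j ω ∈ (Ioo a b)ᶜ
  · rw [if_pos h₁, if_pos (hiff.1 h₁), hset]
  · rw [if_neg h₁, if_neg (mt hiff.2 h₁)]

variable {Ω : Type*} {mΩ : MeasurableSpace Ω} {U : Ω → ℝ≥0 → ℝ}

/-! ### Dependence on the path only through its increments -/

section Congr

variable {Ω' : Type*} {mΩ' : MeasurableSpace Ω'} {U' : Ω' → ℝ≥0 → ℝ}
  (hc : ∀ ω, Continuous (U ω)) (hc' : ∀ ω', Continuous (U' ω')) {ω : Ω} {ω' : Ω'}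
  (hpath : ∀ u, U' ω' u - U' ω' 0 = U ω u - U ω 0)
include hpath

/-- **The truncated flow depends on the path only through its increments**: if the paths `U ω`
and `U' ω'` (of two families, on two sample spaces) have the same increments, the level-`δ`
flows from the same start agree at `ω` and `ω'` (uniqueness of the integrated equation).
[folklore] -/
theorem argTrunc_congr {δ : ℝ} (hδ : 0 < δ) (hδ' : δ ≤ Real.pi / 2) (θ : ℝ) (t : ℝ≥0) :
    argTrunc U' δ hc' hδ hδ' θ t ω' = argTrunc U δ hc hδ hδ' θ t ω := by
  symm
  exact eqOn_argTrunc_of_integral_eq hc' hδ hδ' θ ω' (continuous_argTrunc hc hδ hδ' θ ω)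
    (fun s _ ↦ by rw [hpath s]; exact argTrunc_eq_integral hc hδ hδ' θ ω (t := s)) t le_rfl

/-- The exit times `σ_δ` agree. [folklore] -/
theorem truncExit_congr {δ : ℝ} (hδ : 0 < δ) (hδ' : δ ≤ Real.pi / 2) (θ : ℝ) :
    truncExit U' hc' hδ hδ' θ ω' = truncExit U hc hδ hδ' θ ω :=
  exitTime_eq_of_forall_eq (fun t ↦ argTrunc_congr hc hc' hpath hδ hδ' θ t) _ _

/-- The exit times `σₙ` agree. [folklore] -/
theorem exitLevel_congr (n : ℕ) (θ : ℝ) : exitLevel U' hc' n θ ω' = exitLevel U hc n θ ω :=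
  truncExit_congr hc hc' hpath _ _ θ

/-- The lifetimes agree. [folklore] -/
theorem lifetime_congr (θ : ℝ) : lifetime U' hc' θ ω' = lifetime U hc θ ω := by
  simp only [lifetime, exitLevel_congr hc hc' hpath]

/-- `TopAt` agrees. [folklore] -/
theorem topAt_congr (n : ℕ) (θ : ℝ) : TopAt U' hc' n θ ω' ↔ TopAt U hc n θ ω := by
  simp only [TopAt, exitLevel_congr hc hc' hpath, argLevel, argTrunc_congr hc hc' hpath]

/-- `BotAt` agrees. [folklore] -/
theorem botAt_congr (n : ℕ) (θ : ℝ) : BotAt U' hc' n θ ω' ↔ BotAt U hc n θ ω := by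
  simp only [BotAt, exitLevel_congr hc hc' hpath, argLevel, argTrunc_congr hc hc' hpath]

/-- The exit sides agree: top. [folklore] -/
theorem exitsTop_congr (θ : ℝ) : ExitsTop U' hc' θ ω' ↔ ExitsTop U hc θ ω := by
  simp only [ExitsTop, topAt_congr hc hc' hpath]

/-- The exit sides agree: bottom. [folklore] -/
theorem exitsBot_congr (θ : ℝ) : ExitsBot U' hc' θ ω' ↔ ExitsBot U hc θ ω := by
  simp only [ExitsBot, botAt_congr hc hc' hpath]

/-- The radial Bessel flows agree. [folklore] -/
theorem arg_congr (θ : ℝ) (t : ℝ≥0) : arg U' hc' θ t ω' = arg U hc θ t ω := by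
  by_cases h : ∃ n : ℕ, (t : WithTop ℝ≥0) ≤ exitLevel U hc n θ ω
  · obtain ⟨n, hn⟩ := h
    have hn' : (t : WithTop ℝ≥0) ≤ exitLevel U' hc' n θ ω' := by rwa [exitLevel_congr hc hc' hpath]
    rw [arg_eq_argLevel hc hn, arg_eq_argLevel hc' hn', argLevel, argLevel,
      argTrunc_congr hc hc' hpath]
  · have h' : ¬∃ n : ℕ, (t : WithTop ℝ≥0) ≤ exitLevel U' hc' n θ ω' := by
      simpa only [exitLevel_congr hc hc' hpath] using h
    classical
    rw [arg, arg, dif_neg h, dif_neg h']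

end Congr

/-! ### The time-shifted family and the flow property -/

section Shift

variable (U) in
/-- **The family of driving paths shifted in time by `r`**: `(shiftFam U r) ω u = U ω (r + u)`.
(Only increments of the driving path enter the flow, so no recentring is needed.) [folklore] -/
def shiftFam (r : ℝ≥0) : Ω → ℝ≥0 → ℝ := fun ω u ↦ U ω (r + u)

/-- Unfolding of `shiftFam`. [folklore] -/
@[simp] theorem shiftFam_apply (r : ℝ≥0) (ω : Ω) (u : ℝ≥0) : shiftFam U r ω u = U ω (r + u) :=
  rfl

/-- The shifted paths are continuous. [folklore] -/
theorem continuous_shiftFam (hc : ∀ ω, Continuous (U ω)) (r : ℝ≥0) :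
    ∀ ω, Continuous (shiftFam U r ω) := fun ω ↦
  (hc ω).comp (continuous_const.add continuous_id)

/-- The shifted paths are measurable at each time when the paths are. [folklore] -/
theorem measurable_shiftFam (hmeas : ∀ s, Measurable fun ω ↦ U ω s) (r : ℝ≥0) (u : ℝ≥0) :
    Measurable fun ω ↦ shiftFam U r ω u :=
  hmeas (r + u)

variable (hc : ∀ ω, Continuous (U ω))

/-- **The flow property of the truncated flow**: the level-`δ` flow after time `r` is the
level-`δ` flow of the shifted family started from the position at time `r`:
`Y^δ_{r+u} = Y'^δ_u`, `Y'` driven by `U(r + ·)` from `Y^δ_r` (both sides solve the same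
integrated equation in `u`). Lawler (2005), §1.11 (strong Markov property of the flow of an
SDE with Lipschitz coefficients, here pathwise). [folklore] -/
theorem argTrunc_add {δ : ℝ} (hδ : 0 < δ) (hδ' : δ ≤ Real.pi / 2) (θ : ℝ) (ω : Ω) (r u : ℝ≥0) :
    argTrunc U δ hc hδ hδ' θ (r + u) ω =
      argTrunc (shiftFam U r) δ (continuous_shiftFam hc r) hδ hδ'
        (argTrunc U δ hc hδ hδ' θ r ω) u ω := by
  set θ' := argTrunc U δ hc hδ hδ' θ r ω with hθ'
  -- the integrand along the flow, in real time
  set c : ℝ → ℝ := fun s ↦ cotTrunc δ (argTrunc U δ hc hδ hδ' θ s.toNNReal ω / 2) with hcdef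
  have hcc : Continuous c := (continuous_cotTrunc hδ hδ').comp
    (((continuous_argTrunc hc hδ hδ' θ ω).comp continuous_real_toNNReal).div_const _)
  have hyc : Continuous fun w : ℝ≥0 ↦ argTrunc U δ hc hδ hδ' θ (r + w) ω :=
    (continuous_argTrunc hc hδ hδ' θ ω).comp (continuous_const.add continuous_id)
  refine eqOn_argTrunc_of_integral_eq (continuous_shiftFam hc r) hδ hδ' θ' ω hyc
    (fun v _ ↦ ?_) u le_rfl
  simp only [shiftFam_apply, add_zero]
  have h1 := argTrunc_eq_integral hc hδ hδ' θ ω (t := r + v)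
  have h2 := argTrunc_eq_integral hc hδ hδ' θ ω (t := r)
  -- split `∫₀^{r+v} = ∫₀^r + ∫ᵣ^{r+v}` and shift the second integral
  have hsplit : ∫ s in (0 : ℝ)..((r + v : ℝ≥0) : ℝ), c s =
      (∫ s in (0 : ℝ)..(r : ℝ), c s) + ∫ s in (r : ℝ)..((r + v : ℝ≥0) : ℝ), c s :=
    (intervalIntegral.integral_add_adjacent_intervals (hcc.intervalIntegrable _ _)
      (hcc.intervalIntegrable _ _)).symm
  have hshift : ∫ s in (r : ℝ)..((r + v : ℝ≥0) : ℝ), c s =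
      ∫ w in (0 : ℝ)..(v : ℝ), cotTrunc δ (argTrunc U δ hc hδ hδ' θ (r + w.toNNReal) ω / 2) := by
    rw [NNReal.coe_add]
    have := intervalIntegral.integral_comp_add_right (a := (0 : ℝ)) (b := (v : ℝ)) c (r : ℝ)
    rw [zero_add, show (v : ℝ) + r = r + v by ring] at this
    rw [← this]
    refine intervalIntegral.integral_congr fun w hw ↦ ?_
    rw [uIcc_of_le v.coe_nonneg] at hw
    simp only [hcdef]
    congr 3
    rw [show w + (r : ℝ) = ((r + w.toNNReal : ℝ≥0) : ℝ) by
      rw [NNReal.coe_add, Real.coe_toNNReal _ hw.1]; ring, Real.toNNReal_coe]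
  rw [h1, hsplit, hshift, hθ', h2]
  ring

/-- **Exit times split at a time before them**: if `r ≤ σ_δ(θ)`, then
`σ_δ(θ) = r + σ'_δ(Y^δ_r)`, `σ'` the exit time of the shifted flow. [folklore] -/
theorem truncExit_eq_add {δ : ℝ} (hδ : 0 < δ) (hδ' : δ ≤ Real.pi / 2) (θ : ℝ) (ω : Ω) {r : ℝ≥0}
    (hr : (r : WithTop ℝ≥0) ≤ truncExit U hc hδ hδ' θ ω) :
    truncExit U hc hδ hδ' θ ω = r + truncExit (shiftFam U r) (continuous_shiftFam hc r) hδ hδ'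
      (argTrunc U δ hc hδ hδ' θ r ω) ω := by
  set θ' := argTrunc U δ hc hδ hδ' θ r ω with hθ'
  have hY : ∀ u : ℝ≥0, argTrunc (shiftFam U r) δ (continuous_shiftFam hc r) hδ hδ' θ' u ω =
      argTrunc U δ hc hδ hδ' θ (r + u) ω := fun u ↦ (argTrunc_add hc hδ hδ' θ ω r u).symm
  have hcY := continuous_argTrunc hc hδ hδ' θ ω
  have hcY' := continuous_argTrunc (continuous_shiftFam hc r) hδ hδ' θ' ω
  have hbefore : ∀ j : ℝ≥0, j < r →
      argTrunc U δ hc hδ hδ' θ j ω ∈ Ioo (2 * δ) (2 * Real.pi - 2 * δ) := fun j hj ↦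
    argTrunc_mem_Ioo_of_lt_truncExit hc hδ hδ' θ ω ((WithTop.coe_lt_coe.2 hj).trans_le hr)
  refine withTop_eq_of_forall_le_coe_iff fun t ↦ ?_
  rw [truncExit_def, truncExit_def, Process.exitTime_le_coe_iff hcY]
  constructor
  · rintro ⟨j, hjt, hjout⟩
    have hrj : r ≤ j := by
      by_contra h
      exact hjout (hbefore j (not_le.1 h))
    have hle : Process.exitTime (argTrunc (shiftFam U r) δ (continuous_shiftFam hc r) hδ hδ' θ')
        (2 * δ) (2 * Real.pi - 2 * δ) ω ≤ ((j - r : ℝ≥0) : WithTop ℝ≥0) := by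
      rw [Process.exitTime_le_coe_iff hcY']
      refine ⟨j - r, le_rfl, ?_⟩
      rwa [hY, add_tsub_cancel_of_le hrj]
    calc (r : WithTop ℝ≥0) + _ ≤ (r : WithTop ℝ≥0) + ((j - r : ℝ≥0) : WithTop ℝ≥0) :=
          add_le_add le_rfl hle
      _ = (j : WithTop ℝ≥0) := by rw [← WithTop.coe_add, add_tsub_cancel_of_le hrj]
      _ ≤ t := WithTop.coe_le_coe.2 hjt
  · intro h
    have hne : Process.exitTime (argTrunc (shiftFam U r) δ (continuous_shiftFam hc r) hδ hδ' θ')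
        (2 * δ) (2 * Real.pi - 2 * δ) ω ≠ ⊤ := by
      intro htop
      rw [htop, WithTop.add_top] at h
      exact WithTop.coe_ne_top (top_le_iff.1 h)
    obtain ⟨s, hs⟩ := WithTop.ne_top_iff_exists.1 hne
    rw [← hs, ← WithTop.coe_add, WithTop.coe_le_coe] at h
    obtain ⟨j, hjs, hjout⟩ := (Process.exitTime_le_coe_iff hcY').1 (le_of_eq hs.symm)
    refine ⟨r + j, ?_, ?_⟩
    · exact (add_le_add le_rfl hjs).trans h
    · rwa [hY] at hjout

/-- The level-`n` exit times split: `σₙ(θ) = r + σ'ₙ(Yᵣ)` if `r ≤ σₙ(θ)`. [folklore] -/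
theorem exitLevel_eq_add (n : ℕ) (θ : ℝ) (ω : Ω) {r : ℝ≥0}
    (hr : (r : WithTop ℝ≥0) ≤ exitLevel U hc n θ ω) :
    exitLevel U hc n θ ω =
      r + exitLevel (shiftFam U r) (continuous_shiftFam hc r) n (arg U hc θ r ω) ω := by
  rw [arg_eq_argLevel hc hr]
  exact truncExit_eq_add hc (level_pos n) (level_le n) θ ω hr

/-- The level-`n` flows after `r ≤ σₙ`: `Y^{δₙ}_{r+u} = Y'^{δₙ}_u` with `Y'` the shifted level-`n`
flow from `Yᵣ`. [folklore] -/
theorem argLevel_add (n : ℕ) (θ : ℝ) (ω : Ω) {r : ℝ≥0}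
    (hr : (r : WithTop ℝ≥0) ≤ exitLevel U hc n θ ω) (u : ℝ≥0) :
    argLevel U hc n θ (r + u) ω =
      argLevel (shiftFam U r) (continuous_shiftFam hc r) n (arg U hc θ r ω) u ω := by
  rw [arg_eq_argLevel hc hr]
  exact argTrunc_add hc (level_pos n) (level_le n) θ ω r u

/-- `TopAt n` is decided by the shifted flow (for `r ≤ σₙ`). [folklore] -/
theorem topAt_iff_shiftFam (n : ℕ) (θ : ℝ) (ω : Ω) {r : ℝ≥0}
    (hr : (r : WithTop ℝ≥0) ≤ exitLevel U hc n θ ω) :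
    TopAt U hc n θ ω ↔ TopAt (shiftFam U r) (continuous_shiftFam hc r) n (arg U hc θ r ω) ω := by
  have hE := exitLevel_eq_add hc n θ ω hr
  constructor
  · rintro ⟨t, ht, hyt⟩
    have hrt : r ≤ t := by
      have := hr; rw [ht, WithTop.coe_le_coe] at this; exact this
    refine ⟨t - r, ?_, ?_⟩
    · have h := hE
      rw [ht] at h
      have hne : exitLevel (shiftFam U r) (continuous_shiftFam hc r) n (arg U hc θ r ω) ω ≠ ⊤ := by
        intro htop; rw [htop, WithTop.add_top] at h; exact WithTop.coe_ne_top h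
      obtain ⟨s, hs⟩ := WithTop.ne_top_iff_exists.1 hne
      rw [← hs, ← WithTop.coe_add, WithTop.coe_inj] at h
      rw [← hs, h, add_tsub_cancel_left]
    · rw [← argLevel_add hc n θ ω hr, add_tsub_cancel_of_le hrt]
      exact hyt
  · rintro ⟨s, hs, hys⟩
    refine ⟨r + s, ?_, ?_⟩
    · rw [hE, hs, WithTop.coe_add]
    · rw [argLevel_add hc n θ ω hr]
      exact hys

/-- `BotAt n` is decided by the shifted flow (for `r ≤ σₙ`). [folklore] -/
theorem botAt_iff_shiftFam (n : ℕ) (θ : ℝ) (ω : Ω) {r : ℝ≥0}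
    (hr : (r : WithTop ℝ≥0) ≤ exitLevel U hc n θ ω) :
    BotAt U hc n θ ω ↔ BotAt (shiftFam U r) (continuous_shiftFam hc r) n (arg U hc θ r ω) ω := by
  have hE := exitLevel_eq_add hc n θ ω hr
  constructor
  · rintro ⟨t, ht, hyt⟩
    have hrt : r ≤ t := by
      have := hr; rw [ht, WithTop.coe_le_coe] at this; exact this
    refine ⟨t - r, ?_, ?_⟩
    · have h := hE
      rw [ht] at h
      have hne : exitLevel (shiftFam U r) (continuous_shiftFam hc r) n (arg U hc θ r ω) ω ≠ ⊤ := by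
        intro htop; rw [htop, WithTop.add_top] at h; exact WithTop.coe_ne_top h
      obtain ⟨s, hs⟩ := WithTop.ne_top_iff_exists.1 hne
      rw [← hs, ← WithTop.coe_add, WithTop.coe_inj] at h
      rw [← hs, h, add_tsub_cancel_left]
    · rw [← argLevel_add hc n θ ω hr, add_tsub_cancel_of_le hrt]
      exact hyt
  · rintro ⟨s, hs, hys⟩
    refine ⟨r + s, ?_, ?_⟩
    · rw [hE, hs, WithTop.coe_add]
    · rw [argLevel_add hc n θ ω hr]
      exact hys

/-- **The exit side is that of the restarted flow, top** (for `r < T`): `Y_T = 2π` iff the shifted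
flow from `Yᵣ` leaves through `2π`. [folklore] -/
theorem exitsTop_iff_shiftFam (θ : ℝ) (ω : Ω) {r : ℝ≥0}
    (hr : (r : WithTop ℝ≥0) < lifetime U hc θ ω) :
    ExitsTop U hc θ ω ↔ ExitsTop (shiftFam U r) (continuous_shiftFam hc r) (arg U hc θ r ω) ω := by
  obtain ⟨N, hN⟩ := eventually_lt_exitLevel hc hr
  constructor
  · rintro ⟨N', hN'⟩
    exact ⟨max N N', fun n hn ↦ (topAt_iff_shiftFam hc n θ ω (hN n (le_of_max_le_left hn)).le).1
      (hN' n (le_of_max_le_right hn))⟩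
  · rintro ⟨N', hN'⟩
    exact ⟨max N N', fun n hn ↦ (topAt_iff_shiftFam hc n θ ω (hN n (le_of_max_le_left hn)).le).2
      (hN' n (le_of_max_le_right hn))⟩

/-- **The exit side is that of the restarted flow, bottom** (for `r < T`). [folklore] -/
theorem exitsBot_iff_shiftFam (θ : ℝ) (ω : Ω) {r : ℝ≥0}
    (hr : (r : WithTop ℝ≥0) < lifetime U hc θ ω) :
    ExitsBot U hc θ ω ↔ ExitsBot (shiftFam U r) (continuous_shiftFam hc r) (arg U hc θ r ω) ω := by
  obtain ⟨N, hN⟩ := eventually_lt_exitLevel hc hr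
  constructor
  · rintro ⟨N', hN'⟩
    exact ⟨max N N', fun n hn ↦ (botAt_iff_shiftFam hc n θ ω (hN n (le_of_max_le_left hn)).le).1
      (hN' n (le_of_max_le_right hn))⟩
  · rintro ⟨N', hN'⟩
    exact ⟨max N N', fun n hn ↦ (botAt_iff_shiftFam hc n θ ω (hN n (le_of_max_le_left hn)).le).2
      (hN' n (le_of_max_le_right hn))⟩

/-- Tails of the increasing sequence of exit times have the same supremum. [folklore] -/
theorem lifetime_eq_iSup_add (hc' : ∀ ω, Continuous (U ω)) (θ : ℝ) (ω : Ω) (N : ℕ) :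
    lifetime U hc' θ ω = ⨆ n : ℕ, exitLevel U hc' (n + N) θ ω := by
  rw [lifetime]
  exact ((exitLevel_mono hc' θ ω).iSup_nat_add N).symm

/-- **The lifetime splits at a time before it**: `T(θ) = r + T'(Yᵣ)` for `r < T(θ)`, `T'` the
lifetime of the flow of the shifted family restarted from `Yᵣ` (LSW (2002), proof of Lemma 2.2:
the conditional law of `T` given `𝓕ᵣ` on `{r < T}`). [folklore] -/
theorem lifetime_eq_add (θ : ℝ) (ω : Ω) {r : ℝ≥0} (hr : (r : WithTop ℝ≥0) < lifetime U hc θ ω) :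
    lifetime U hc θ ω = r + lifetime (shiftFam U r) (continuous_shiftFam hc r) (arg U hc θ r ω) ω := by
  obtain ⟨N, hN⟩ := eventually_lt_exitLevel hc hr
  set hc' := continuous_shiftFam hc r
  set θ' := arg U hc θ r ω
  have hlev : ∀ n, exitLevel U hc (n + N) θ ω = r + exitLevel (shiftFam U r) hc' (n + N) θ' ω :=
    fun n ↦ exitLevel_eq_add hc (n + N) θ ω (hN _ (Nat.le_add_left N n)).le
  rw [lifetime_eq_iSup_add hc θ ω N, lifetime_eq_iSup_add hc' θ' ω N]
  simp_rw [hlev]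
  exact iSup_coe_add_eq r _

/-- **The flow property of the radial Bessel flow**: `Y_{r+u} = Y'_u` for `r + u ≤ σₙ` (some
level `n`), `Y'` the flow of the shifted family restarted from `Yᵣ`. [folklore] -/
theorem arg_add {n : ℕ} (θ : ℝ) (ω : Ω) {r u : ℝ≥0}
    (hru : ((r + u : ℝ≥0) : WithTop ℝ≥0) ≤ exitLevel U hc n θ ω) :
    arg U hc θ (r + u) ω = arg (shiftFam U r) (continuous_shiftFam hc r) (arg U hc θ r ω) u ω := by
  have hr : (r : WithTop ℝ≥0) ≤ exitLevel U hc n θ ω :=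
    le_trans (WithTop.coe_le_coe.2 (le_self_add)) hru
  have hE := exitLevel_eq_add hc n θ ω hr
  have hu : (u : WithTop ℝ≥0) ≤ exitLevel (shiftFam U r) (continuous_shiftFam hc r) n
      (arg U hc θ r ω) ω := by
    have h := hru
    rw [hE, WithTop.coe_add] at h
    exact (WithTop.add_le_add_iff_left WithTop.coe_ne_top).1 h
  rw [arg_eq_argLevel hc hru, arg_eq_argLevel (continuous_shiftFam hc r) hu]
  exact argLevel_add hc n θ ω hr u

end Shift

/-! ### Joint measurability in the starting point and the sample -/

section JointMeasurable

variable (hc : ∀ ω, Continuous (U ω))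

/-- **The truncated flow is `1`-Lipschitz in the starting point** (contraction,
`sub_argTrunc_mem_Icc`). [cite: Lawler2005, §1.11.2] -/
theorem lipschitzWith_argTrunc {δ : ℝ} (hδ : 0 < δ) (hδ' : δ ≤ Real.pi / 2) (t : ℝ≥0) (ω : Ω) :
    LipschitzWith 1 fun θ : ℝ ↦ argTrunc U δ hc hδ hδ' θ t ω := by
  refine LipschitzWith.of_dist_le_mul fun θ₁ θ₂ ↦ ?_
  rw [NNReal.coe_one, one_mul, Real.dist_eq, Real.dist_eq]
  rcases le_total θ₁ θ₂ with h | h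
  · have := sub_argTrunc_mem_Icc hc hδ hδ' h ω t
    rw [abs_sub_comm, abs_of_nonneg this.1, abs_sub_comm, abs_of_nonneg (sub_nonneg.2 h)]
    exact this.2
  · have := sub_argTrunc_mem_Icc hc hδ hδ' h ω t
    rw [abs_of_nonneg this.1, abs_of_nonneg (sub_nonneg.2 h)]
    exact this.2

/-- The truncated flow is continuous in the starting point. [folklore] -/
theorem continuous_argTrunc_start {δ : ℝ} (hδ : 0 < δ) (hδ' : δ ≤ Real.pi / 2) (t : ℝ≥0)
    (ω : Ω) : Continuous fun θ : ℝ ↦ argTrunc U δ hc hδ hδ' θ t ω :=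
  (lipschitzWith_argTrunc hc hδ hδ' t ω).continuous

/-- **Joint measurability of the truncated flow in `(θ, ω)`** at each time `t` (continuous in
`θ`, measurable in `ω`: Carathéodory), when the path values at times `≤ t` are measurable.
[folklore] -/
theorem measurable_argTrunc_prod {δ : ℝ} (hδ : 0 < δ) (hδ' : δ ≤ Real.pi / 2) {t : ℝ≥0}
    (hmeas : ∀ s, s ≤ t → Measurable fun ω ↦ U ω s) :
    Measurable fun p : ℝ × Ω ↦ argTrunc U δ hc hδ hδ' p.1 t p.2 :=
  measurable_uncurry_of_continuous_of_measurable (u := fun θ ω ↦ argTrunc U δ hc hδ hδ' θ t ω)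
    (fun ω ↦ continuous_argTrunc_start hc hδ hδ' t ω) (fun θ ↦ measurable_argTrunc hc hδ hδ' hmeas θ)

/-- The level-`n` flow read as a process on the product space `ℝ × Ω` (start, sample).
[folklore] -/
theorem measurable_argLevel_prod (hmeas : ∀ s, Measurable fun ω ↦ U ω s) (n : ℕ) (t : ℝ≥0) :
    Measurable fun p : ℝ × Ω ↦ argLevel U hc n p.1 t p.2 :=
  measurable_argTrunc_prod hc (level_pos n) (level_le n) fun s _ ↦ hmeas s

/-- The level-`n` flow on the product space is adapted to the constant filtration. [folklore] -/
theorem adapted_argLevel_prod (hmeas : ∀ s, Measurable fun ω ↦ U ω s) (n : ℕ) :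
    Adapted (Filtration.const ℝ≥0 (inferInstance : MeasurableSpace (ℝ × Ω)) le_rfl)
      (fun (t : ℝ≥0) (p : ℝ × Ω) ↦ argLevel U hc n p.1 t p.2) := fun t ↦
  measurable_argLevel_prod hc hmeas n t

/-- The exit time of the product-space process is `σₙ`. [folklore] -/
theorem exitTime_argLevel_prod (n : ℕ) (p : ℝ × Ω) :
    Process.exitTime (fun (t : ℝ≥0) (p : ℝ × Ω) ↦ argLevel U hc n p.1 t p.2) (2 * level n)
      (2 * Real.pi - 2 * level n) p = exitLevel U hc n p.1 p.2 :=
  exitTime_eq_of_forall_eq (fun _ ↦ rfl) _ _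

/-- **Joint measurability of `σₙ` in `(θ, ω)`** (hitting time of a closed set by the jointly
measurable continuous product-space process). [folklore] -/
theorem measurable_exitLevel_prod (hmeas : ∀ s, Measurable fun ω ↦ U ω s) (n : ℕ) :
    Measurable fun p : ℝ × Ω ↦ exitLevel U hc n p.1 p.2 := by
  have h := (Process.isStoppingTime_exitTime (a := 2 * level n) (b := 2 * Real.pi - 2 * level n)
    (adapted_argLevel_prod hc hmeas n)
    (fun p ↦ continuous_argTrunc hc (level_pos n) (level_le n) p.1 p.2)).measurable'
  have hfun : Process.exitTime (fun (t : ℝ≥0) (p : ℝ × Ω) ↦ argLevel U hc n p.1 t p.2) (2 * level n)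
      (2 * Real.pi - 2 * level n) = fun p ↦ exitLevel U hc n p.1 p.2 :=
    funext (exitTime_argLevel_prod hc n)
  rw [hfun] at h
  exact h

/-- The level-`n` flow stopped at `σₙ`, at time `k`, is jointly measurable in `(θ, ω)`.
[folklore] -/
theorem measurable_stoppedProcess_argLevel_prod (hmeas : ∀ s, Measurable fun ω ↦ U ω s) (n : ℕ)
    (k : ℝ≥0) :
    Measurable fun p : ℝ × Ω ↦
      stoppedProcess (argLevel U hc n p.1) (exitLevel U hc n p.1) k p.2 := by
  have h := (Process.stronglyAdapted_stoppedProcess_exitTime (a := 2 * level n)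
    (b := 2 * Real.pi - 2 * level n) (adapted_argLevel_prod hc hmeas n)
    (fun p ↦ continuous_argTrunc hc (level_pos n) (level_le n) p.1 p.2) k).measurable
  have heq : ∀ p : ℝ × Ω, stoppedProcess (fun (t : ℝ≥0) (p : ℝ × Ω) ↦ argLevel U hc n p.1 t p.2)
      (Process.exitTime (fun (t : ℝ≥0) (p : ℝ × Ω) ↦ argLevel U hc n p.1 t p.2) (2 * level n)
        (2 * Real.pi - 2 * level n)) k p =
      stoppedProcess (argLevel U hc n p.1) (exitLevel U hc n p.1) k p.2 := by
    intro p
    simp only [stoppedProcess, exitTime_argLevel_prod]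
  rw [funext heq] at h
  exact h.mono le_rfl le_rfl

/-- **`TopAt n` is jointly measurable in `(θ, ω)`.** [folklore] -/
theorem measurableSet_topAt_prod (hmeas : ∀ s, Measurable fun ω ↦ U ω s) (n : ℕ) :
    MeasurableSet {p : ℝ × Ω | TopAt U hc n p.1 p.2} := by
  have : {p : ℝ × Ω | TopAt U hc n p.1 p.2} = ⋃ k : ℕ, {p | stoppedProcess (argLevel U hc n p.1)
      (exitLevel U hc n p.1) k p.2 = 2 * Real.pi - 2 * level n} := by
    ext p; simp only [mem_setOf_eq, topAt_iff_exists_nat, mem_iUnion]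
  rw [this]
  exact MeasurableSet.iUnion fun k ↦
    (measurable_stoppedProcess_argLevel_prod hc hmeas n k) (measurableSet_singleton _)

/-- **`BotAt n` is jointly measurable in `(θ, ω)`.** [folklore] -/
theorem measurableSet_botAt_prod (hmeas : ∀ s, Measurable fun ω ↦ U ω s) (n : ℕ) :
    MeasurableSet {p : ℝ × Ω | BotAt U hc n p.1 p.2} := by
  have : {p : ℝ × Ω | BotAt U hc n p.1 p.2} = ⋃ k : ℕ, {p | stoppedProcess (argLevel U hc n p.1)
      (exitLevel U hc n p.1) k p.2 = 2 * level n} := by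
    ext p; simp only [mem_setOf_eq, botAt_iff_exists_nat, mem_iUnion]
  rw [this]
  exact MeasurableSet.iUnion fun k ↦
    (measurable_stoppedProcess_argLevel_prod hc hmeas n k) (measurableSet_singleton _)

/-- **`ExitsTop` is jointly measurable in `(θ, ω)`.** [folklore] -/
theorem measurableSet_exitsTop_prod (hmeas : ∀ s, Measurable fun ω ↦ U ω s) :
    MeasurableSet {p : ℝ × Ω | ExitsTop U hc p.1 p.2} := by
  have : {p : ℝ × Ω | ExitsTop U hc p.1 p.2} =
      ⋃ N : ℕ, ⋂ n : ℕ, {p | N ≤ n → TopAt U hc n p.1 p.2} := by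
    ext p; simp only [ExitsTop, mem_setOf_eq, mem_iUnion, mem_iInter]
  rw [this]
  refine MeasurableSet.iUnion fun N ↦ MeasurableSet.iInter fun n ↦ ?_
  by_cases h : N ≤ n
  · simp only [h, forall_const]; exact measurableSet_topAt_prod hc hmeas n
  · simp only [h, IsEmpty.forall_iff, setOf_true]; exact MeasurableSet.univ

/-- **`ExitsBot` is jointly measurable in `(θ, ω)`.** [folklore] -/
theorem measurableSet_exitsBot_prod (hmeas : ∀ s, Measurable fun ω ↦ U ω s) :
    MeasurableSet {p : ℝ × Ω | ExitsBot U hc p.1 p.2} := by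
  have : {p : ℝ × Ω | ExitsBot U hc p.1 p.2} =
      ⋃ N : ℕ, ⋂ n : ℕ, {p | N ≤ n → BotAt U hc n p.1 p.2} := by
    ext p; simp only [ExitsBot, mem_setOf_eq, mem_iUnion, mem_iInter]
  rw [this]
  refine MeasurableSet.iUnion fun N ↦ MeasurableSet.iInter fun n ↦ ?_
  by_cases h : N ≤ n
  · simp only [h, forall_const]; exact measurableSet_botAt_prod hc hmeas n
  · simp only [h, IsEmpty.forall_iff, setOf_true]; exact MeasurableSet.univ

/-- **The lifetime is jointly measurable in `(θ, ω)`** (supremum of the `σₙ`). [folklore] -/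
theorem measurable_lifetime_prod (hmeas : ∀ s, Measurable fun ω ↦ U ω s) :
    Measurable fun p : ℝ × Ω ↦ lifetime U hc p.1 p.2 := by
  unfold lifetime
  exact Measurable.iSup fun n ↦ measurable_exitLevel_prod hc hmeas n

/-- The radial Bessel flow at time `t` is jointly measurable in `(θ, ω)` on `{t < T}` in the
following form: for each level `n`, `(θ, ω) ↦ Y_{t ∧ σₙ}` is jointly measurable. [folklore] -/
theorem measurable_arg_min_exitLevel_prod (hmeas : ∀ s, Measurable fun ω ↦ U ω s) (n : ℕ)
    (t : ℝ≥0) :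
    Measurable fun p : ℝ × Ω ↦
      arg U hc p.1 (min (t : WithTop ℝ≥0) (exitLevel U hc n p.1 p.2)).untopA p.2 := by
  have hle : ∀ σ : WithTop ℝ≥0, (((min (t : WithTop ℝ≥0) σ).untopA : ℝ≥0) : WithTop ℝ≥0) ≤ σ := by
    intro σ
    induction σ using WithTop.recTopCoe with
    | top => exact le_top
    | coe s => rw [← WithTop.coe_min]; exact WithTop.coe_le_coe.2 (min_le_right t s)
  have heq : ∀ p : ℝ × Ω,
      arg U hc p.1 (min (t : WithTop ℝ≥0) (exitLevel U hc n p.1 p.2)).untopA p.2 =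
        stoppedProcess (argLevel U hc n p.1) (exitLevel U hc n p.1) t p.2 := fun p ↦
    arg_eq_argLevel hc (hle _)
  simp_rw [heq]
  exact measurable_stoppedProcess_argLevel_prod hc hmeas n t

end JointMeasurable

end RadialLoewner

end Literature.Probability.RandomPlanarGeometry
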